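import Summits.ABC.IUTFork.LanaLogLinkLiftingChecks
import Literature.AnabelianGeometry.AbsoluteAnabelian.MonoidKummerMapsIdRigidProofs
import Literature.FieldTheory.Galois.FixingSubgroupAbsoluteGalois
import Literature.AnabelianGeometry.AbsoluteAnabelian.AbsAnabProp121viiSub
import Literature.NumberTheory.Transcendental.PadicLogAlgClProofs
import HarnessLib

/-!
# L-LANA objects IX octies: automorphisms of the GM-data `(G_{ℚ_p} ↷ O^▷_{ℚ̄_p})` extend to `ℚ̄_pˣ` and PRESERVE `| · |_p`

Record-only, proof-only sequel (D-0012; seat abc-iut-c312-4 gen 6, L-LANA level, plan/LLANA-SPEC N1/N3/N12) of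
`LanaLogLinkLiftingChecks.lean` (the `ℚ_p` reference pair `padicPair p = (G_{ℚ_p} ↷ O^▷_{ℚ̄_p})`, [AbsTopIII] Def. 3.1 (ii),
LANA Table 1 `F_v` with `Π_v := G_v`) and `LanaLogLinkLiftingHolds.lean` (gen 5: LANA §5.3 (a) unique lifting holds at
this datum GRANTED the continuity clause `hcont` of LANA Def. 3.7.1 p. 20 — isomorphisms of GM-data are HOMEOMORPHISMS
on the monoid — which [AbsTopIII] Rmk. 3.1.1 p. 70 omits).  TAKES NO SIDE on [IUTchIII] Cor. 3.12.  Gen 5 left `hcont`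
OPEN, noting in prose that the lift of an exotic automorphism of `G_{ℚ_p}` "preserves `|·|_p` but need not respect the
higher unit filtrations uniformly".  THIS file makes the first half a KERNEL THEOREM for EVERY automorphism
`e = (e_G, e_M)` of the pair, with NO class field theory:
* §1–§2 `extEquiv e : ℚ̄_pˣ ≃* ℚ̄_pˣ` — `e_M` extends to the group of fractions of the cancellative monoid `O^▷`
  (`x = (pⁿx)/pⁿ`; `extFun_eq_of_mul_eq`: value `e_M(a)/e_M(b)` on ANY fraction `a/b`), multiplicative, bijective
  (inverse from `e⁻¹`), restricting to `e_M` on `O^▷` (`extHom_intMonoidUnits`);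
* §3 `extEquiv_smul` — `ψ_e(σ·x) = e_G(σ)·ψ_e(x)`: `ψ_e` is `e_G`-equivariant in the sense of layer L4's
  `Prop121vii.IsAlphaEquivariant` ([AbsAnab] Prop. 1.2.1 (vi)), over Mathlib's `Field.absoluteGaloisGroup ℚ_[p]` via the
  identity `padicGalAbs` — the hypothesis shape under which abc-iut-L6-t13 proved such a `ψ` is THE LCFT transport `ψ̄`
  up to inversion (`IsAlphaEquivariant.eq_or_eq_inv`); the identification `ψ_e = ψ̄` is the sequel's;
* §4 `norm_isoM_pInt`: `|e_M(p)| = |p|` — `e_M(p)`, `e_M⁻¹(p)` are `G_{ℚ_p}`-fixed, so in `ℤ_p ∖ 0` with norms `p^{-b}`,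
  `p^{-c}`; `G`-fixed `y = pᵏu` (`|u| = 1`; units of `O^▷` go to units) give `|e_M(y)| = |e_M(p)|ᵏ`, whence
  `p⁻¹ = |e_M(e_M⁻¹(p))| = p^{-bc}`, `b = 1`;
* §5 `norm_extEquiv`, `norm_isoM`: `|ψ_e(x)|_p = |x|_p` on ALL of `ℚ̄_pˣ`, so `|e_M(a)| = |a|` on `O^▷` (value group:
  `‖xⁿpᵐ‖ = 1`, the tree's `IwasawaLog.exists_norm_pow_mul_zpow_eq_one` from Mathlib's spectral-norm formula).
HONEST SCOPE.  NOT `hcont` itself: continuity of `e_M` on `O^▷_{ℚ̄_p}` is continuity of `ψ_e` at `1` on principal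
units UNIFORMLY over all finite `K/ℚ_p` (each `ψ_e : O_K^× ⥲ O_{K'}^×` alone is bi-continuous, both profinite); whether
an exotic automorphism of `G_{ℚ_p}` admits such uniform control stays OPEN — recorded, not judged.
[cite: LANA2026Report, Def. 3.7.1 p. 20, §5.3 (a) p. 29, §0.4 (b) p. 8] [cite: MochizukiAbsTopIII2015, Definition 3.1 (ii) p.67]
[cite: MochizukiAbsAnab2004, Prop 1.2.1 (iii) p.10] NOT here: any judgement.
-/

noncomputable section

namespace Summit.ABC
namespace IUTFork

open Literature.AnabelianGeometry.AbsoluteAnabelian Field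
open scoped NNReal

namespace PadicPairIso

variable (p : ℕ) [Fact p.Prime]

/-- `|z| = 1 ⟺ ‖z‖ = 1` (Mathlib: the valuation of `PadicAlgCl p` is the `ℝ≥0`-valued norm). [folklore] -/
theorem padicVal_eq_one_iff_norm (z : PadicAlgCl p) : padicVal p z = 1 ↔ ‖z‖ = 1 := by
  rw [padicVal, PadicAlgCl.valuation_def, ← NNReal.coe_eq_one, coe_nnnorm]
/-- `|z| ≤ 1 ⟺ ‖z‖ ≤ 1`. [folklore] -/
theorem padicVal_le_one_iff_norm (z : PadicAlgCl p) : padicVal p z ≤ 1 ↔ ‖z‖ ≤ 1 := by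
  rw [padicVal, PadicAlgCl.valuation_def, ← NNReal.coe_le_coe, coe_nnnorm, NNReal.coe_one]

/-- Membership in `O^▷_{ℚ̄_p}` in terms of the norm: non-zero of norm `≤ 1`. [cite: LANA2026Report, §0.4 (b) p. 8] -/
theorem mem_intMonoid_iff_norm (z : PadicAlgCl p) : z ∈ intMonoid (padicVal p) ↔ z ≠ 0 ∧ ‖z‖ ≤ 1 := by
  rw [mem_intMonoid_iff, Valuation.pos_iff, padicVal_le_one_iff_norm]

/-- `‖p‖ = p⁻¹` in `ℚ̄_p`. [folklore] -/
theorem norm_natCast_p : ‖(p : PadicAlgCl p)‖ = (p : ℝ)⁻¹ := by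
  rw [← PadicAlgCl.valuation_coe, PadicAlgCl.valuation_p, one_div, NNReal.coe_inv, NNReal.coe_natCast]

/-- **`O^▷ ↪ ℚ̄_pˣ`**: an element of `O^▷ = {0 < |a| ≤ 1}` is a unit of the field `ℚ̄_p` ("`O^▷_k = O_k ∖ {0}`").
[cite: LANA2026Report, §0.4 (b) p. 8] -/
def intMonoidUnits : intMonoid (padicVal p) →* (PadicAlgCl p)ˣ where
  toFun a := Units.mk0 (a : PadicAlgCl p) ((Valuation.pos_iff _).mp a.2.1)
  map_one' := Units.ext rfl
  map_mul' _ _ := Units.ext rfl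

/-- The underlying field element of `intMonoidUnits a` is `a`. [cite: LANA2026Report, §0.4 (b) p. 8] -/
@[simp] theorem coe_intMonoidUnits (a : intMonoid (padicVal p)) :
    ((intMonoidUnits p a : (PadicAlgCl p)ˣ) : PadicAlgCl p) = a := rfl

/-- **`ℚ̄_pˣ` is the group of fractions of `O^▷` with denominators powers of `p`**: for every `x ∈ ℚ̄_pˣ` some
`pⁿ·x` lies in `O^▷` (`|p| < 1`, Archimedean property of `ℝ≥0`). [cite: LANA2026Report, §0.4 (b) p. 8] -/
theorem exists_pow_mul_mem_intMonoid (x : (PadicAlgCl p)ˣ) :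
    ∃ n : ℕ, (p : PadicAlgCl p) ^ n * (x : PadicAlgCl p) ∈ intMonoid (padicVal p) := by
  have hp0 : 0 < padicVal p (p : PadicAlgCl p) := (p_mem_intMonoid p).1
  have hp1 : padicVal p (p : PadicAlgCl p) < 1 := by
    rw [padicVal, PadicAlgCl.valuation_p, one_div]
    exact inv_lt_one_of_one_lt₀ (by exact_mod_cast (Fact.out : p.Prime).one_lt)
  have hx0 : 0 < padicVal p (x : PadicAlgCl p) := (Valuation.pos_iff _).mpr x.ne_zero
  obtain ⟨n, hn⟩ := exists_pow_lt_of_lt_one (inv_pos.mpr hx0) hp1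
  refine ⟨n, by rw [map_mul, map_pow]; exact mul_pos (pow_pos hp0 n) hx0, ?_⟩
  rw [map_mul, map_pow]
  exact (mul_le_mul_of_nonneg_right hn.le zero_le).trans_eq (inv_mul_cancel₀ hx0.ne')

/-- A chosen exponent `n(x)` with `p^{n(x)}·x ∈ O^▷`. [cite: LANA2026Report, §0.4 (b) p. 8] -/
def liftExp (x : (PadicAlgCl p)ˣ) : ℕ := Classical.choose (exists_pow_mul_mem_intMonoid p x)

/-- The numerator `p^{n(x)}·x ∈ O^▷` of `x`. [cite: LANA2026Report, §0.4 (b) p. 8] -/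
def liftNum (x : (PadicAlgCl p)ˣ) : intMonoid (padicVal p) :=
  ⟨_, Classical.choose_spec (exists_pow_mul_mem_intMonoid p x)⟩

/-- `p ∈ O^▷` as an element of the monoid. [cite: LANA2026Report, §0.4 (b) p. 8] -/
def pInt : intMonoid (padicVal p) := ⟨(p : PadicAlgCl p), p_mem_intMonoid p⟩

/-- Underlying element of `pInt`. [cite: LANA2026Report, §0.4 (b) p. 8] -/
@[simp] theorem coe_pInt : ((pInt p : intMonoid (padicVal p)) : PadicAlgCl p) = p := rfl
/-- The defining fraction: `x · p^{n(x)} = (numerator of x)` in `ℚ̄_p`. [cite: LANA2026Report, §0.4 (b) p. 8] -/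
theorem coe_mul_pInt_pow_liftExp (x : (PadicAlgCl p)ˣ) :
    (x : PadicAlgCl p) * ((pInt p ^ liftExp p x : intMonoid (padicVal p)) : PadicAlgCl p) =
      ((liftNum p x : intMonoid (padicVal p)) : PadicAlgCl p) := by
  rw [SubmonoidClass.coe_pow, coe_pInt, mul_comm]
  rfl

section Extension

variable (e : GaloisMonoidPair.Iso (padicPair p) (padicPair p))

/-- `θ_e := (O^▷ ↪ ℚ̄_pˣ) ∘ e_M`. [cite: MochizukiAbsTopIII2015, Definition 3.1 (ii) p.67] -/
def isoMUnits : intMonoid (padicVal p) →* (PadicAlgCl p)ˣ := (intMonoidUnits p).comp e.isoM.toMonoidHom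

/-- Underlying element of `θ_e a` is `e_M a`. [cite: MochizukiAbsTopIII2015, Definition 3.1 (ii) p.67] -/
@[simp] theorem coe_isoMUnits (a : intMonoid (padicVal p)) :
    ((isoMUnits p e a : (PadicAlgCl p)ˣ) : PadicAlgCl p) = ((e.isoM a : intMonoid (padicVal p)) : PadicAlgCl p) :=
  rfl

/-- **The extension of `e_M` to `ℚ̄_pˣ`, as a function**: `ψ_e(x) := e_M(p^{n(x)}x) · e_M(p)^{-n(x)}`.
[cite: LANA2026Report, Def. 3.7.1 p. 20] [cite: MochizukiAbsTopIII2015, Definition 3.1 (ii) p.67] -/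
def extFun (x : (PadicAlgCl p)ˣ) : (PadicAlgCl p)ˣ :=
  isoMUnits p e (liftNum p x) * (isoMUnits p e (pInt p) ^ liftExp p x)⁻¹

/-- **Well-definedness**: on ANY fraction `x = a/b` with `a, b ∈ O^▷`, `ψ_e(x) = e_M(a) · e_M(b)⁻¹` — `O^▷` is a
cancellative monoid and `e_M` is multiplicative. [cite: LANA2026Report, Def. 3.7.1 p. 20] -/
theorem extFun_eq_of_mul_eq {x : (PadicAlgCl p)ˣ} {a b : intMonoid (padicVal p)}
    (h : (x : PadicAlgCl p) * (b : PadicAlgCl p) = a) :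
    extFun p e x = isoMUnits p e a * (isoMUnits p e b)⁻¹ := by
  have key : liftNum p x * b = a * pInt p ^ liftExp p x := by
    apply Subtype.ext
    change ((p : PadicAlgCl p) ^ liftExp p x * (x : PadicAlgCl p)) * (b : PadicAlgCl p) =
      (a : PadicAlgCl p) * ((pInt p ^ liftExp p x : intMonoid (padicVal p)) : PadicAlgCl p)
    rw [SubmonoidClass.coe_pow, coe_pInt, mul_assoc, h, mul_comm]
  have hθ := congrArg (isoMUnits p e) key
  rw [map_mul, map_mul, map_pow] at hθ
  rw [extFun, mul_inv_eq_iff_eq_mul, eq_mul_inv_of_mul_eq hθ, mul_right_comm]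

/-- `ψ_e(1) = 1`. [cite: LANA2026Report, Def. 3.7.1 p. 20] -/
theorem extFun_one : extFun p e 1 = 1 := by
  rw [extFun_eq_of_mul_eq p e (a := 1) (b := 1) (by rw [Units.val_one, one_mul]), map_one, inv_one, mul_one]

/-- `ψ_e` is multiplicative. [cite: LANA2026Report, Def. 3.7.1 p. 20] -/
theorem extFun_mul (x y : (PadicAlgCl p)ˣ) : extFun p e (x * y) = extFun p e x * extFun p e y := by
  have hx := coe_mul_pInt_pow_liftExp p x
  have hy := coe_mul_pInt_pow_liftExp p y
  have hxy : ((x * y : (PadicAlgCl p)ˣ) : PadicAlgCl p) *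
      ((pInt p ^ liftExp p x * pInt p ^ liftExp p y : intMonoid (padicVal p)) : PadicAlgCl p) =
      ((liftNum p x * liftNum p y : intMonoid (padicVal p)) : PadicAlgCl p) := by
    rw [Units.val_mul, Submonoid.coe_mul, Submonoid.coe_mul, ← hx, ← hy]
    ring
  rw [extFun_eq_of_mul_eq p e hxy, extFun_eq_of_mul_eq p e hx, extFun_eq_of_mul_eq p e hy, map_mul, map_mul,
    mul_inv, mul_mul_mul_comm]

/-- **`ψ_e : ℚ̄_pˣ →* ℚ̄_pˣ`**. [cite: LANA2026Report, Def. 3.7.1 p. 20] [cite: MochizukiAbsTopIII2015, Definition 3.1 (ii) p.67] -/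
def extHom : (PadicAlgCl p)ˣ →* (PadicAlgCl p)ˣ where
  toFun := extFun p e
  map_one' := extFun_one p e
  map_mul' := extFun_mul p e

/-- `extHom` is `extFun`. [cite: LANA2026Report, Def. 3.7.1 p. 20] -/
@[simp] theorem extHom_apply (x : (PadicAlgCl p)ˣ) : extHom p e x = extFun p e x := rfl
/-- **`ψ_e` extends `e_M`**: on `O^▷ ⊆ ℚ̄_pˣ` it is `e_M`. [cite: LANA2026Report, Def. 3.7.1 p. 20] -/
theorem extHom_intMonoidUnits (a : intMonoid (padicVal p)) :
    extHom p e (intMonoidUnits p a) = intMonoidUnits p (e.isoM a) := by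
  have h : ((intMonoidUnits p a : (PadicAlgCl p)ˣ) : PadicAlgCl p) *
      (((1 : intMonoid (padicVal p)) : intMonoid (padicVal p)) : PadicAlgCl p) = (a : PadicAlgCl p) := by
    rw [coe_intMonoidUnits, OneMemClass.coe_one, mul_one]
  rw [extHom_apply, extFun_eq_of_mul_eq p e h, map_one, inv_one, mul_one]
  rfl

/-- Two pair isomorphisms whose monoid components are mutually inverse have mutually inverse extensions.
[cite: LANA2026Report, Def. 3.7.1 p. 20] -/
theorem extHom_extHom_of_inverse (e e' : GaloisMonoidPair.Iso (padicPair p) (padicPair p))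
    (hinv : ∀ a, e.isoM (e'.isoM a) = a) (x : (PadicAlgCl p)ˣ) : extHom p e (extHom p e' x) = x := by
  have hx := coe_mul_pInt_pow_liftExp p x
  have h1 : extHom p e' x = isoMUnits p e' (liftNum p x) * (isoMUnits p e' (pInt p ^ liftExp p x))⁻¹ :=
    extFun_eq_of_mul_eq p e' hx
  have h2 : ((extHom p e' x : (PadicAlgCl p)ˣ) : PadicAlgCl p) *
      ((e'.isoM (pInt p ^ liftExp p x) : intMonoid (padicVal p)) : PadicAlgCl p) =
      ((e'.isoM (liftNum p x) : intMonoid (padicVal p)) : PadicAlgCl p) := by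
    have h3 : extHom p e' x * isoMUnits p e' (pInt p ^ liftExp p x) = isoMUnits p e' (liftNum p x) := by
      rw [h1, inv_mul_cancel_right]
    simpa only [Units.val_mul, coe_isoMUnits] using congrArg (fun u : (PadicAlgCl p)ˣ => (u : PadicAlgCl p)) h3
  rw [extHom_apply, extFun_eq_of_mul_eq p e h2]
  have hab : ∀ c, isoMUnits p e (e'.isoM c) = intMonoidUnits p c := fun c => by
    change intMonoidUnits p (e.isoM (e'.isoM c)) = _
    rw [hinv]
  rw [hab, hab]
  exact (eq_mul_inv_of_mul_eq (Units.ext hx)).symm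

/-- **`ψ_e : ℚ̄_pˣ ⥲ ℚ̄_pˣ`**: the extension of `e_M` is a multiplicative automorphism of `ℚ̄_pˣ`, with inverse
the extension of `e_M⁻¹`. [cite: LANA2026Report, Def. 3.7.1 p. 20] [cite: MochizukiAbsTopIII2015, Definition 3.1 (ii) p.67] -/
def extEquiv : (PadicAlgCl p)ˣ ≃* (PadicAlgCl p)ˣ :=
  { extHom p e with
    invFun := extHom p e.symm'
    left_inv := extHom_extHom_of_inverse p e.symm' e (fun a => e.isoM.symm_apply_apply a)
    right_inv := extHom_extHom_of_inverse p e e.symm' (fun a => e.isoM.apply_symm_apply a) }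

/-- `extEquiv` is `extHom` as a function. [cite: LANA2026Report, Def. 3.7.1 p. 20] -/
@[simp] theorem extEquiv_apply (x : (PadicAlgCl p)ˣ) : extEquiv p e x = extHom p e x := rfl
/-- `ψ_e` restricted to `O^▷` is `e_M` (units form). [cite: LANA2026Report, Def. 3.7.1 p. 20] -/
theorem extEquiv_intMonoidUnits (a : intMonoid (padicVal p)) :
    extEquiv p e (intMonoidUnits p a) = intMonoidUnits p (e.isoM a) := by
  rw [extEquiv_apply, extHom_intMonoidUnits]

/-- `G_{ℚ_p}` in the two spellings of the tree: the identity `Gal(ℚ̄_p/ℚ_p) = PadicGal p ⥲ Field.absoluteGaloisGroup ℚ_[p]`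
(layer L4's [AbsAnab] files use the latter). [folklore] -/
abbrev padicGalAbs : PadicGal p ≃ₜ* absoluteGaloisGroup ℚ_[p] :=
  Literature.FieldTheory.Galois.algEquivContinuousMulEquivAbsoluteGaloisGroup ℚ_[p]

/-- The `G`-component `e_G` of the pair automorphism, read on `Field.absoluteGaloisGroup ℚ_[p]`.
[cite: MochizukiAbsTopIII2015, Definition 3.1 (ii) p.67] -/
def galComponent : absoluteGaloisGroup ℚ_[p] ≃ₜ* absoluteGaloisGroup ℚ_[p] :=
  (padicGalAbs p).symm.trans (e.isoPi.trans (padicGalAbs p))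

/-- `e_M` carries `G`-FIXED elements of `O^▷` to `G`-fixed elements (equivariance + surjectivity of `e_G`).
[cite: MochizukiAbsTopIII2015, Definition 3.1 (ii) p.67] -/
theorem isoM_fixed {a : (padicPair p).M} (ha : ∀ g : (padicPair p).Pi, g • a = a) (g : (padicPair p).Pi) :
    g • e.isoM a = e.isoM a := by
  obtain ⟨h, rfl⟩ := e.isoPi.surjective g
  exact (e.smul_comm h a).symm.trans (congrArg e.isoM (ha h))

/-- `p ∈ O^▷` is `G_{ℚ_p}`-fixed. [folklore] -/
theorem smul_pInt (g : (padicPair p).Pi) : g • (pInt p : (padicPair p).M) = pInt p :=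
  Subtype.ext (by
    show ((padicRef p).ρ g : PadicGal p) (p : PadicAlgCl p) = p
    exact map_natCast _ p)

/-- **`ψ_e` is `e_G`-equivariant**: `ψ_e(σ · x) = e_G(σ) · ψ_e(x)` for `σ ∈ G_{ℚ_p}`, `x ∈ ℚ̄_pˣ` — write `x = a/b`
with `a, b ∈ O^▷`, then `σx = σa/σb` and `e_M(σa) = e_G(σ) e_M(a)`. [cite: LANA2026Report, Def. 3.7.1 p. 20]
[cite: MochizukiAbsAnab2004, Prop 1.2.1 (vi) p.10] -/
theorem extEquiv_smul (σ : absoluteGaloisGroup ℚ_[p]) (x : (PadicAlgCl p)ˣ) :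
    extEquiv p e (σ • x) = galComponent p e σ • extEquiv p e x := by
  let g : (padicPair p).Pi := (padicGalAbs p).symm σ
  have hx := coe_mul_pInt_pow_liftExp p x
  have hsm : ∀ a : (padicPair p).M, ((e.isoM (g • a) : (padicPair p).M) : PadicAlgCl p) =
      e.isoPi g • ((e.isoM a : (padicPair p).M) : PadicAlgCl p) := fun a =>
    congrArg (fun c : (padicPair p).M => (c : PadicAlgCl p)) (e.smul_comm g a)
  have hσx : ((σ • x : (PadicAlgCl p)ˣ) : PadicAlgCl p) *
      ((g • (pInt p ^ liftExp p x) : (padicPair p).M) : PadicAlgCl p) =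
      ((g • liftNum p x : (padicPair p).M) : PadicAlgCl p) := by
    have h2 : g • ((x : PadicAlgCl p) * ((pInt p ^ liftExp p x : intMonoid (padicVal p)) : PadicAlgCl p)) =
        g • ((liftNum p x : intMonoid (padicVal p)) : PadicAlgCl p) := by
      rw [hx]
    rw [smul_mul'] at h2
    exact h2
  have hθ : ∀ a : (padicPair p).M, isoMUnits p e (g • a) = galComponent p e σ • isoMUnits p e a :=
    fun a => Units.ext (hsm a)
  rw [extEquiv_apply, extEquiv_apply, extHom_apply, extHom_apply, extFun_eq_of_mul_eq p e hσx,
    extFun_eq_of_mul_eq p e hx, hθ, hθ, ← smul_inv', ← smul_mul']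

end Extension

section Norms

variable (e : GaloisMonoidPair.Iso (padicPair p) (padicPair p))

/-- `e_M` preserves the UNITS `O^× = {|a| = 1}` of the monoid `O^▷` (the invertible elements; any monoid
isomorphism does). [cite: LANA2026Report, §0.4 (b) p. 8] -/
theorem padicVal_isoM_eq_one_iff (a : intMonoid (padicVal p)) :
    padicVal p ((e.isoM a : intMonoid (padicVal p)) : PadicAlgCl p) = 1 ↔ padicVal p (a : PadicAlgCl p) = 1 := by
  rw [← isUnit_intMonoid_iff (padicVal p) (e.isoM a), ← isUnit_intMonoid_iff]
  exact isUnit_map_iff e.isoM a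

/-- Norm form: `‖e_M a‖ = 1 ⟺ ‖a‖ = 1`. [cite: LANA2026Report, §0.4 (b) p. 8] -/
theorem norm_isoM_eq_one_iff (a : intMonoid (padicVal p)) :
    ‖((e.isoM a : intMonoid (padicVal p)) : PadicAlgCl p)‖ = 1 ↔ ‖(a : PadicAlgCl p)‖ = 1 := by
  rw [← padicVal_eq_one_iff_norm, ← padicVal_eq_one_iff_norm, padicVal_isoM_eq_one_iff]

/-- A `G_{ℚ_p}`-fixed element of `ℚ̄_p` of norm `≤ 1` has norm `p^{-k}` for a NATURAL number `k` (it lies in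
`ℤ_p`: Galois descent `fixed_iff_mem_range` + `‖y₀‖ = p^{-v(y₀)}` on `ℚ_p`). [folklore] -/
theorem exists_norm_eq_of_fixed {y : PadicAlgCl p} (hy0 : y ≠ 0) (hfix : ∀ σ : PadicGal p, σ • y = y)
    (hle : ‖y‖ ≤ 1) : ∃ k : ℕ, ‖y‖ = ((p : ℝ)⁻¹) ^ k := by
  obtain ⟨y₀, rfl⟩ := (fixed_iff_mem_range p y).mp hfix
  have hy₀ : y₀ ≠ 0 := by
    rintro rfl
    exact hy0 (map_zero _)
  have hn : ‖algebraMap ℚ_[p] (PadicAlgCl p) y₀‖ = ‖y₀‖ := PadicAlgCl.norm_extends p y₀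
  rw [hn] at hle ⊢
  obtain ⟨k, hk⟩ := Int.eq_ofNat_of_zero_le ((Padic.norm_le_one_iff_val_nonneg y₀).mp hle)
  refine ⟨k, ?_⟩
  rw [Padic.norm_eq_zpow_neg_valuation hy₀, hk, inv_pow, ← zpow_natCast, zpow_neg]

/-- For a `G_{ℚ_p}`-fixed `y ∈ O^▷` with `‖y‖ = p^{-k}`: `‖e_M(y)‖ = ‖e_M(p)‖ᵏ` — since `y = pᵏ·u` with `|u| = 1` and
`e_M` is multiplicative and preserves `O^×`. [cite: LANA2026Report, §0.4 (b) p. 8] -/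
theorem norm_isoM_of_norm_eq_pow {y : intMonoid (padicVal p)} {k : ℕ} (hk : ‖(y : PadicAlgCl p)‖ = ((p : ℝ)⁻¹) ^ k) :
    ‖((e.isoM y : intMonoid (padicVal p)) : PadicAlgCl p)‖ =
      ‖((e.isoM (pInt p) : intMonoid (padicVal p)) : PadicAlgCl p)‖ ^ k := by
  have hp0 : (p : PadicAlgCl p) ≠ 0 := by exact_mod_cast (Fact.out : p.Prime).ne_zero
  have hpk : ((p : PadicAlgCl p) ^ k) ≠ 0 := pow_ne_zero _ hp0
  set u : PadicAlgCl p := (y : PadicAlgCl p) / (p : PadicAlgCl p) ^ k with hu_def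
  have hpn : ‖(p : PadicAlgCl p) ^ k‖ = ((p : ℝ)⁻¹) ^ k := by rw [norm_pow, norm_natCast_p]
  have hpR : ((p : ℝ)⁻¹) ^ k ≠ 0 := pow_ne_zero _ (inv_ne_zero (by exact_mod_cast (Fact.out : p.Prime).ne_zero))
  have hu : ‖u‖ = 1 := by
    rw [hu_def, norm_div, hk, hpn, div_self hpR]
  have huO : u ∈ intMonoid (padicVal p) := by
    rw [mem_intMonoid_iff_norm]
    exact ⟨fun h => by rw [h, norm_zero] at hu; exact zero_ne_one hu, hu.le⟩
  have hy : y = pInt p ^ k * ⟨u, huO⟩ := by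
    apply Subtype.ext
    change (y : PadicAlgCl p) = ((pInt p ^ k : intMonoid (padicVal p)) : PadicAlgCl p) * u
    rw [SubmonoidClass.coe_pow, coe_pInt, hu_def, mul_div_cancel₀ _ hpk]
  have hu1 : ‖((e.isoM ⟨u, huO⟩ : intMonoid (padicVal p)) : PadicAlgCl p)‖ = 1 :=
    (norm_isoM_eq_one_iff p e ⟨u, huO⟩).mpr hu
  rw [hy, map_mul, map_pow, Submonoid.coe_mul, SubmonoidClass.coe_pow, norm_mul, norm_pow, hu1, mul_one]

/-- `e_M(p)` is `G_{ℚ_p}`-fixed (as an element of `ℚ̄_p`), for every pair automorphism `e`.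
[cite: MochizukiAbsTopIII2015, Definition 3.1 (ii) p.67] -/
theorem smul_coe_isoM_pInt (σ : PadicGal p) :
    σ • ((e.isoM (pInt p) : intMonoid (padicVal p)) : PadicAlgCl p) =
      ((e.isoM (pInt p) : intMonoid (padicVal p)) : PadicAlgCl p) :=
  congrArg (fun c : (padicPair p).M => (c : PadicAlgCl p)) (isoM_fixed p e (smul_pInt p) σ)

/-- **`|e_M(p)|_p = |p|_p = p⁻¹` for EVERY automorphism `e` of the pair `(G_{ℚ_p} ↷ O^▷_{ℚ̄_p})`**: with
`‖e_M(p)‖ = p^{-b}`, `‖e_M⁻¹(p)‖ = p^{-c}` (both `G`-fixed in `O^▷`), `p⁻¹ = ‖e_M(e_M⁻¹(p))‖ = p^{-bc}` forces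
`bc = 1`, `b = 1`. [cite: LANA2026Report, Def. 3.7.1 p. 20] [cite: MochizukiAbsAnab2004, Prop 1.2.1 (iv) p.10] -/
theorem norm_isoM_pInt : ‖((e.isoM (pInt p) : intMonoid (padicVal p)) : PadicAlgCl p)‖ = (p : ℝ)⁻¹ := by
  have hne : ∀ f : GaloisMonoidPair.Iso (padicPair p) (padicPair p),
      ((f.isoM (pInt p) : intMonoid (padicVal p)) : PadicAlgCl p) ≠ 0 := fun f =>
    ((mem_intMonoid_iff_norm p _).mp (f.isoM (pInt p)).2).1
  have hle : ∀ f : GaloisMonoidPair.Iso (padicPair p) (padicPair p),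
      ‖((f.isoM (pInt p) : intMonoid (padicVal p)) : PadicAlgCl p)‖ ≤ 1 := fun f =>
    ((mem_intMonoid_iff_norm p _).mp (f.isoM (pInt p)).2).2
  obtain ⟨b, hb⟩ := exists_norm_eq_of_fixed p (hne e) (smul_coe_isoM_pInt p e) (hle e)
  obtain ⟨c, hc⟩ := exists_norm_eq_of_fixed p (hne e.symm') (smul_coe_isoM_pInt p e.symm') (hle e.symm')
  have h := norm_isoM_of_norm_eq_pow p e hc
  have hinv : e.isoM (e.symm'.isoM (pInt p)) = pInt p := e.isoM.apply_symm_apply _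
  rw [hinv, coe_pInt, norm_natCast_p, hb, ← pow_mul] at h
  have hp_pos : (0 : ℝ) < (p : ℝ)⁻¹ := inv_pos.mpr (by exact_mod_cast (Fact.out : p.Prime).pos)
  have hp_ne : ((p : ℝ)⁻¹) ≠ 1 := by
    rw [Ne, inv_eq_one]
    exact_mod_cast (Fact.out : p.Prime).ne_one
  have hbc : b * c = 1 := by
    have h1 : ((p : ℝ)⁻¹) ^ (b * c) = ((p : ℝ)⁻¹) ^ 1 := by rw [pow_one]; exact h.symm
    exact pow_right_injective₀ hp_pos hp_ne h1
  rw [hb, Nat.eq_one_of_mul_eq_one_right hbc, pow_one]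

/-- `‖ψ_e(u)‖ = 1` when `‖u‖ = 1` (`u ∈ O^×`, and `ψ_e = e_M` there). [cite: LANA2026Report, §0.4 (b) p. 8] -/
theorem norm_extEquiv_of_norm_eq_one {u : (PadicAlgCl p)ˣ} (hu : ‖(u : PadicAlgCl p)‖ = 1) :
    ‖((extEquiv p e u : (PadicAlgCl p)ˣ) : PadicAlgCl p)‖ = 1 := by
  have huO : (u : PadicAlgCl p) ∈ intMonoid (padicVal p) := (mem_intMonoid_iff_norm p _).mpr ⟨u.ne_zero, hu.le⟩
  have h : u = intMonoidUnits p ⟨u, huO⟩ := Units.ext rfl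
  rw [h, extEquiv_intMonoidUnits, coe_intMonoidUnits, norm_isoM_eq_one_iff]
  exact hu

/-- **VALUATION PRESERVATION on `ℚ̄_pˣ`**: `‖ψ_e(x)‖ = ‖x‖` for every automorphism `e` of the pair
`(G_{ℚ_p} ↷ O^▷_{ℚ̄_p})` and every `x ∈ ℚ̄_pˣ` — by the value group of `ℚ̄_p` (`‖xⁿ·pᵐ‖ = 1` for some `n ≥ 1`,
`m ∈ ℤ`: the tree's `IwasawaLog.exists_norm_pow_mul_zpow_eq_one`, from Mathlib's spectral-norm formula),
`‖ψ_e(u)‖ = 1` for `‖u‖ = 1`, and `‖ψ_e(p)‖ = ‖p‖`.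
[cite: LANA2026Report, Def. 3.7.1 p. 20] [cite: MochizukiAbsAnab2004, Prop 1.2.1 (iii) p.10] -/
theorem norm_extEquiv (x : (PadicAlgCl p)ˣ) :
    ‖((extEquiv p e x : (PadicAlgCl p)ˣ) : PadicAlgCl p)‖ = ‖(x : PadicAlgCl p)‖ := by
  obtain ⟨n, hn, m, hm⟩ :=
    Literature.NumberTheory.Transcendental.IwasawaLog.exists_norm_pow_mul_zpow_eq_one (p := p) x.ne_zero
  let pU : (PadicAlgCl p)ˣ := intMonoidUnits p (pInt p)
  have hpU : ‖(pU : PadicAlgCl p)‖ = (p : ℝ)⁻¹ := norm_natCast_p p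
  have hp0 : ((p : ℝ)⁻¹) ≠ 0 := inv_ne_zero (by exact_mod_cast (Fact.out : p.Prime).ne_zero)
  let u : (PadicAlgCl p)ˣ := x ^ n * pU ^ m
  have hu : ‖(u : PadicAlgCl p)‖ = 1 := by
    change ‖((x ^ n * pU ^ m : (PadicAlgCl p)ˣ) : PadicAlgCl p)‖ = 1
    rw [Units.val_mul, Units.val_zpow_eq_zpow_val, Units.val_pow_eq_pow_val]
    exact hm
  have hxn : ‖(x : PadicAlgCl p)‖ ^ n = ((p : ℝ)⁻¹) ^ (-m) := by
    have h1 : ‖(x : PadicAlgCl p)‖ ^ n * ((p : ℝ)⁻¹) ^ m = 1 := by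
      rw [← hpU, ← norm_pow, ← norm_zpow, ← norm_mul]
      exact hm
    rw [zpow_neg]
    exact eq_inv_of_mul_eq_one_left h1
  have hψp : ‖((extEquiv p e pU : (PadicAlgCl p)ˣ) : PadicAlgCl p)‖ = (p : ℝ)⁻¹ := by
    change ‖((extEquiv p e (intMonoidUnits p (pInt p)) : (PadicAlgCl p)ˣ) : PadicAlgCl p)‖ = _
    rw [extEquiv_intMonoidUnits, coe_intMonoidUnits, norm_isoM_pInt]
  have hx_eq : x ^ n = u * pU ^ (-m) := by
    change x ^ n = x ^ n * pU ^ m * pU ^ (-m)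
    rw [mul_assoc, ← zpow_add, add_neg_cancel, zpow_zero, mul_one]
  have h : ‖((extEquiv p e x : (PadicAlgCl p)ˣ) : PadicAlgCl p)‖ ^ n = ‖(x : PadicAlgCl p)‖ ^ n := by
    rw [← norm_pow, ← Units.val_pow_eq_pow_val, ← map_pow, hx_eq, map_mul, map_zpow, Units.val_mul, norm_mul,
      Units.val_zpow_eq_zpow_val, norm_zpow, norm_extEquiv_of_norm_eq_one p e hu, hψp, one_mul, hxn]
  exact (pow_left_inj₀ (norm_nonneg _) (norm_nonneg _) hn.ne').mp h

/-- **`|e_M(a)|_p = |a|_p` on `O^▷_{ℚ̄_p}`** for EVERY automorphism `e` of the pair `(G_{ℚ_p} ↷ O^▷_{ℚ̄_p})` — the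
`|·|`-clause of LANA Def. 3.7.1's homeomorphism requirement holds automatically at the `ℚ_p` datum (norm form).
[cite: LANA2026Report, Def. 3.7.1 p. 20] [cite: MochizukiAbsAnab2004, Prop 1.2.1 (iii) p.10] -/
theorem norm_isoM (a : intMonoid (padicVal p)) :
    ‖((e.isoM a : intMonoid (padicVal p)) : PadicAlgCl p)‖ = ‖(a : PadicAlgCl p)‖ := by
  have h := norm_extEquiv p e (intMonoidUnits p a)
  rwa [extEquiv_intMonoidUnits, coe_intMonoidUnits, coe_intMonoidUnits] at h

end Norms

end PadicPairIso

end IUTFork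

end Summit.ABC

end
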